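import Literature.NumberTheory.LFunctions.ConreyIwaniec2002MeanValueDefs
import Mathlib.Analysis.Calculus.BumpFunction.FiniteDimension
import Mathlib.Analysis.Distribution.SchwartzSpace.Fourier
import Mathlib.Analysis.Calculus.IteratedDeriv.Lemmas
import Mathlib.Analysis.Calculus.ContDiff.Bounds
import HarnessLib

/-!
# Conrey–Iwaniec (2002), §6 (6.1)–(6.3): an admissible kernel dominating `𝟙_{[1,2]}`

B. Conrey, H. Iwaniec, Acta Arith. 103 (2002), §5 (5.18) and §6 (6.1)–(6.3) [held text
`paper:arxiv-math_0111012`, p0014:L21–L52]: "`𝒜(T) = ∫ K(t/T)|A(it)|² dt` where `K(u)` is a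
non-negative function on `ℝ` such that `K(u) ≥ 1` for `½ ≤ u ≤ 3` … We assume that the cut-off
function `K(u)` … is continuous and symetric on `ℝ` with `K(0) = 0` (6.1) … the cosine-Fourier
transform `L(v) = 2∫₀^∞ K(u)cos(uv)du` (6.2) has fast decaying derivatives, specifically
`|L^{(j)}(v)| ≤ (1+|v|)^{-4}`, `0 ≤ j ≤ 5` (6.3). Clearly any smooth, symmetric and compactly
supported function on `ℝ ∖ {0}` does satisfy the above conditions up to a constant factor."

PROVED HERE (registered stub S1 `stub_kernel` of SKELETON P64, cell landau-siegel/ls-inputs, line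
`thm61-cm-convolution`; signature verbatim): there is a kernel `K` with `IsCIKernel K` (the tree's
rendering of (6.1)–(6.3), `ConreyIwaniec2002MeanValueDefs.lean`), `K ≥ 0`, and `K ≥ c₀ > 0` on
`[1, 2]` (Proposition 6.4 integrates over `[T, 2T]`). Construction: `K₀(u) = φ(u) + φ(−u)` with `φ`
Mathlib's smooth bump `ContDiffBump (3/2)` (`= 1` on `[1,2]`, supported in `(1/2, 5/2)`); its
cosine transform is `v ↦ 𝓕φ(v/2π) + 𝓕φ(−v/2π)` with `𝓕φ` a Schwartz function, whence (6.3) up to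
a constant `C ≥ 1`; `K = K₀/C`.

## References
* [ConreyIwaniec2002] B. Conrey, H. Iwaniec, Acta Arith. 103 (2002) 259–312: §5 (5.18); §6 (6.1)–(6.3).
-/

noncomputable section

open Complex MeasureTheory Set
open scoped FourierTransform ContDiff SchwartzMap

namespace Literature.NumberTheory.LFunctions

namespace ConreyIwaniec2002

namespace KernelConstruction

/-- The smooth bump `φ` centred at `3/2` with inner radius `1/2` and outer radius `1`
(`φ = 1` on `[1,2]`, `supp φ = (1/2, 5/2)`). [cite: ConreyIwaniec2002, §6 (6.1)] -/
private def bump : ContDiffBump (3 / 2 : ℝ) := ⟨1 / 2, 1, by norm_num, by norm_num⟩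

/-- `φ` as a function. [cite: ConreyIwaniec2002, §6 (6.1)] -/
private def φ : ℝ → ℝ := bump

/-- The symmetrised bump `K₀(u) = φ(u) + φ(−u)`. [cite: ConreyIwaniec2002, §6 (6.1)] -/
private def K₀ (u : ℝ) : ℝ := φ u + φ (-u)

/-- Auxiliary (proof-internal). [folklore] -/
private theorem φ_nonneg (u : ℝ) : 0 ≤ φ u := bump.nonneg' u

/-- Auxiliary (proof-internal). [folklore] -/
private theorem φ_contDiff : ContDiff ℝ ∞ φ := bump.contDiff

/-- Auxiliary (proof-internal). [folklore] -/
private theorem φ_continuous : Continuous φ := bump.continuous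

/-- Auxiliary (proof-internal). [folklore] -/
private theorem φ_hasCompactSupport : HasCompactSupport φ := bump.hasCompactSupport

/-- `φ(u) = 0` for `u ≤ 1/2`. [cite: ConreyIwaniec2002, §6 (6.1)] -/
private theorem φ_eq_zero_of_le {u : ℝ} (hu : u ≤ 1 / 2) : φ u = 0 := by
  apply bump.zero_of_le_dist
  show (1 : ℝ) ≤ dist u (3 / 2)
  rw [Real.dist_eq, abs_of_nonpos (by linarith)]
  linarith

/-- `φ(u) = 1` for `u ∈ [1,2]`. [cite: ConreyIwaniec2002, §6 (6.1)] -/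
private theorem φ_eq_one {u : ℝ} (hu : u ∈ Icc (1 : ℝ) 2) : φ u = 1 := by
  apply bump.one_of_mem_closedBall
  rw [Metric.mem_closedBall, Real.dist_eq]
  show |u - 3 / 2| ≤ 1 / 2
  rw [abs_le]; constructor <;> linarith [hu.1, hu.2]

/-- Auxiliary (proof-internal). [folklore] -/
private theorem K₀_nonneg (u : ℝ) : 0 ≤ K₀ u := add_nonneg (φ_nonneg _) (φ_nonneg _)

/-- Auxiliary (proof-internal). [folklore] -/
private theorem K₀_even (u : ℝ) : K₀ (-u) = K₀ u := by
  simp [K₀, add_comm]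

/-- Auxiliary (proof-internal). [folklore] -/
private theorem K₀_zero : K₀ 0 = 0 := by
  simp [K₀, φ_eq_zero_of_le (show (0:ℝ) ≤ 1/2 by norm_num)]

/-- Auxiliary (proof-internal). [folklore] -/
private theorem K₀_continuous : Continuous K₀ :=
  φ_continuous.add (φ_continuous.comp continuous_neg)

/-- Auxiliary (proof-internal). [folklore] -/
private theorem K₀_hasCompactSupport : HasCompactSupport K₀ :=
  φ_hasCompactSupport.add (φ_hasCompactSupport.comp_homeomorph (Homeomorph.neg ℝ))

/-- Auxiliary (proof-internal). [folklore] -/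
private theorem K₀_eq_one {u : ℝ} (hu : u ∈ Icc (1 : ℝ) 2) : K₀ u = 1 := by
  have h1 : φ u = 1 := φ_eq_one hu
  have h2 : φ (-u) = 0 := φ_eq_zero_of_le (by linarith [hu.1])
  simp [K₀, h1, h2]

/-- On `u > 0`, `K₀ = φ`. [cite: ConreyIwaniec2002, §6 (6.1)] -/
private theorem K₀_eq_φ_of_pos {u : ℝ} (hu : 0 < u) : K₀ u = φ u := by
  have : φ (-u) = 0 := φ_eq_zero_of_le (by linarith)
  simp [K₀, this]

/-! ### The cosine transform through the Schwartz Fourier transform -/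

/-- `φ` as a complex-valued function. [cite: ConreyIwaniec2002, §6 (6.2)] -/
private def φc (u : ℝ) : ℂ := (φ u : ℂ)

/-- Auxiliary (proof-internal). [folklore] -/
private theorem φc_contDiff : ContDiff ℝ ∞ φc := ofRealCLM.contDiff.comp φ_contDiff

/-- Auxiliary (proof-internal). [folklore] -/
private theorem φc_hasCompactSupport : HasCompactSupport φc :=
  φ_hasCompactSupport.comp_left (g := fun x : ℝ => (x : ℂ)) ofReal_zero

/-- `φ` as a Schwartz function. [cite: ConreyIwaniec2002, §6 (6.2)] -/
private def φS : 𝓢(ℝ, ℂ) := φc_hasCompactSupport.toSchwartzMap φc_contDiff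

/-- The Fourier transform of `φ` (a Schwartz function). [cite: ConreyIwaniec2002, §6 (6.2)] -/
private def φF : 𝓢(ℝ, ℂ) := 𝓕 φS

/-- Auxiliary (proof-internal). [folklore] -/
private theorem φS_apply (u : ℝ) : φS u = (φ u : ℂ) := rfl

/-- Auxiliary (proof-internal). [folklore] -/
private theorem φF_apply (ξ : ℝ) :
    φF ξ = ∫ u : ℝ, Complex.exp (↑(-2 * Real.pi * u * ξ) * I) * (φ u : ℂ) := by
  show (𝓕 φS : 𝓢(ℝ, ℂ)) ξ = _
  have : ((𝓕 φS : 𝓢(ℝ, ℂ)) : ℝ → ℂ) = 𝓕 (φS : ℝ → ℂ) := SchwartzMap.fourier_coe φS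
  rw [this, Real.fourier_real_eq_integral_exp_smul]
  simp [φS_apply, smul_eq_mul]

/-- The complexified cosine transform `G(v) = 𝓕φ(v/2π) + 𝓕φ(−v/2π)`.
[cite: ConreyIwaniec2002, §6 (6.2)] -/
private def G (v : ℝ) : ℂ := φF ((2 * Real.pi)⁻¹ * v) + φF (-(2 * Real.pi)⁻¹ * v)

/-- Auxiliary (proof-internal). [folklore] -/
private theorem G_eq (v : ℝ) : G v = ((ciL K₀ v : ℝ) : ℂ) := by
  have hint : Integrable (fun u : ℝ => (φ u : ℂ)) :=
    (φ_continuous.integrable_of_hasCompactSupport φ_hasCompactSupport).ofReal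
  have hcs : ∀ w : ℝ, HasCompactSupport (fun u : ℝ =>
      Complex.exp (↑(-2 * Real.pi * u * w) * I) * (φ u : ℂ)) := fun w =>
    φc_hasCompactSupport.mul_left
  have hi1 : Integrable (fun u : ℝ => Complex.exp (↑(-2 * Real.pi * u * ((2 * Real.pi)⁻¹ * v)) * I) *
      (φ u : ℂ)) :=
    Continuous.integrable_of_hasCompactSupport
      ((by fun_prop : Continuous fun u : ℝ => Complex.exp (↑(-2 * Real.pi * u * ((2 * Real.pi)⁻¹ * v)) * I)).mul
        (continuous_ofReal.comp φ_continuous)) (hcs _)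
  have hi2 : Integrable (fun u : ℝ => Complex.exp (↑(-2 * Real.pi * u * (-(2 * Real.pi)⁻¹ * v)) * I) *
      (φ u : ℂ)) :=
    Continuous.integrable_of_hasCompactSupport
      ((by fun_prop : Continuous fun u : ℝ => Complex.exp (↑(-2 * Real.pi * u * (-(2 * Real.pi)⁻¹ * v)) * I)).mul
        (continuous_ofReal.comp φ_continuous)) (hcs _)
  unfold G
  rw [φF_apply, φF_apply, ← integral_add hi1 hi2]
  -- pointwise: e^{-iuv} φ + e^{iuv} φ = 2 cos(uv) φ
  have hpt : ∀ u : ℝ, Complex.exp (↑(-2 * Real.pi * u * ((2 * Real.pi)⁻¹ * v)) * I) * (φ u : ℂ) +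
      Complex.exp (↑(-2 * Real.pi * u * (-(2 * Real.pi)⁻¹ * v)) * I) * (φ u : ℂ) =
      (((2 * (φ u * Real.cos (u * v)) : ℝ)) : ℂ) := by
    intro u
    have hpi : (2 * Real.pi : ℝ) ≠ 0 := by positivity
    have e1 : (-2 * Real.pi * u * ((2 * Real.pi)⁻¹ * v) : ℝ) = -(u * v) := by field_simp
    have e2 : (-2 * Real.pi * u * (-(2 * Real.pi)⁻¹ * v) : ℝ) = u * v := by field_simp
    rw [e1, e2]
    have h2 := Complex.two_cos ((u : ℂ) * v)
    push_cast
    rw [show (-(↑u * ↑v) : ℂ) * I = -(↑u * ↑v) * I by ring]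
    linear_combination (↑(φ u) : ℂ) * h2.symm
  rw [integral_congr_ae (Filter.Eventually.of_forall hpt)]
  -- now both sides are `∫ 2 φ cos` as a complex number
  rw [integral_complex_ofReal]
  congr 1
  unfold ciL
  rw [integral_const_mul]
  congr 1
  rw [← setIntegral_eq_integral_of_forall_compl_eq_zero (s := Ioi (0:ℝ)) (fun u hu => by
    rw [mem_Ioi, not_lt] at hu
    rw [φ_eq_zero_of_le (by linarith), zero_mul])]
  exact setIntegral_congr_fun measurableSet_Ioi fun u hu => by rw [K₀_eq_φ_of_pos hu]

/-! ### Derivative bounds -/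

/-- Auxiliary (proof-internal). [folklore] -/
private theorem φF_contDiff (n : ℕ∞) : ContDiff ℝ n (φF : ℝ → ℂ) := φF.smooth n

/-- Schwartz decay of the derivatives of `𝓕φ` in the form `(1+|x|)⁴‖(𝓕φ)^{(j)}(x)‖ ≤ C`.
[cite: ConreyIwaniec2002, §6 (6.3)] -/
private theorem φF_deriv_bound (j : ℕ) :
    ∃ C : ℝ, 0 ≤ C ∧ ∀ x : ℝ, (1 + |x|) ^ 4 * ‖iteratedDeriv j (φF : ℝ → ℂ) x‖ ≤ C := by
  obtain ⟨C₀, hC₀, h0⟩ := φF.decay 0 j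
  obtain ⟨C₄, hC₄, h4⟩ := φF.decay 4 j
  refine ⟨8 * (C₀ + C₄), by positivity, fun x => ?_⟩
  have e : ‖iteratedFDeriv ℝ j (φF : ℝ → ℂ) x‖ = ‖iteratedDeriv j (φF : ℝ → ℂ) x‖ :=
    norm_iteratedFDeriv_eq_norm_iteratedDeriv
  have a0 := h0 x
  have a4 := h4 x
  rw [e] at a0 a4
  simp only [pow_zero, one_mul] at a0
  rw [Real.norm_eq_abs] at a4
  have hD : 0 ≤ ‖iteratedDeriv j (φF : ℝ → ℂ) x‖ := norm_nonneg _
  have hx : 0 ≤ |x| := abs_nonneg x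
  -- `(1+|x|)⁴ ≤ 8(1 + |x|⁴)`
  have h8 : (1 + |x|) ^ 4 ≤ 8 * (1 + |x| ^ 4) := by
    nlinarith [sq_nonneg (|x| - 1), sq_nonneg (|x| + 1), sq_nonneg (|x| ^ 2 - 1), hx,
      pow_nonneg hx 3]
  calc (1 + |x|) ^ 4 * ‖iteratedDeriv j (φF : ℝ → ℂ) x‖
      ≤ 8 * (1 + |x| ^ 4) * ‖iteratedDeriv j (φF : ℝ → ℂ) x‖ :=
        mul_le_mul_of_nonneg_right h8 hD
    _ = 8 * (‖iteratedDeriv j (φF : ℝ → ℂ) x‖ + |x| ^ 4 * ‖iteratedDeriv j (φF : ℝ → ℂ) x‖) := by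
        ring
    _ ≤ 8 * (C₀ + C₄) := by gcongr

/-- Auxiliary (proof-internal). [folklore] -/
private theorem G_contDiff (n : ℕ∞) : ContDiff ℝ n G := by
  unfold G
  exact ((φF_contDiff n).comp (contDiff_const.mul contDiff_id)).add
    ((φF_contDiff n).comp (contDiff_const.mul contDiff_id))

/-- `(1+|v|)⁴ ‖G^{(j)}(v)‖ ≤ B_j`. [cite: ConreyIwaniec2002, §6 (6.3)] -/
private theorem G_deriv_bound (j : ℕ) :
    ∃ B : ℝ, 0 ≤ B ∧ ∀ v : ℝ, (1 + |v|) ^ 4 * ‖iteratedDeriv j G v‖ ≤ B := by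
  obtain ⟨C, hC, hCb⟩ := φF_deriv_bound j
  refine ⟨2 * (2 * Real.pi) ^ 4 * C, by positivity, fun v => ?_⟩
  set c : ℝ := (2 * Real.pi)⁻¹ with hc
  have hπ : 0 < 2 * Real.pi := by positivity
  have hc0 : 0 < c := by rw [hc]; positivity
  have hc1 : c ≤ 1 := by
    rw [hc]; apply inv_le_one_of_one_le₀; linarith [Real.pi_gt_three]
  have hsm : ContDiff ℝ j (φF : ℝ → ℂ) := φF_contDiff j
  -- the two summands
  have h1 : iteratedDeriv j (fun x : ℝ => (φF : ℝ → ℂ) (c * x)) v =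
      c ^ j • iteratedDeriv j (φF : ℝ → ℂ) (c * v) := by
    rw [iteratedDeriv_comp_const_smul hsm c]
  have h2 : iteratedDeriv j (fun x : ℝ => (φF : ℝ → ℂ) (-c * x)) v =
      (-c) ^ j • iteratedDeriv j (φF : ℝ → ℂ) (-c * v) := by
    rw [iteratedDeriv_comp_const_smul hsm (-c)]
  have hG : G = (fun x : ℝ => (φF : ℝ → ℂ) (c * x)) + fun x : ℝ => (φF : ℝ → ℂ) (-c * x) := by
    ext x; simp [G, hc]
  have hd1 : ContDiffAt ℝ j (fun x : ℝ => (φF : ℝ → ℂ) (c * x)) v :=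
    (hsm.comp (contDiff_const.mul contDiff_id)).contDiffAt
  have hd2 : ContDiffAt ℝ j (fun x : ℝ => (φF : ℝ → ℂ) (-c * x)) v :=
    (hsm.comp (contDiff_const.mul contDiff_id)).contDiffAt
  rw [hG, iteratedDeriv_add hd1 hd2, h1, h2]
  -- norms
  have hb1 := hCb (c * v)
  have hb2 := hCb (-c * v)
  have hn1 : ‖c ^ j • iteratedDeriv j (φF : ℝ → ℂ) (c * v)‖ ≤ ‖iteratedDeriv j (φF : ℝ → ℂ) (c * v)‖ := by
    rw [norm_smul, norm_pow, Real.norm_eq_abs, abs_of_pos hc0]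
    exact mul_le_of_le_one_left (norm_nonneg _) (pow_le_one₀ hc0.le hc1)
  have hn2 : ‖(-c) ^ j • iteratedDeriv j (φF : ℝ → ℂ) (-c * v)‖ ≤
      ‖iteratedDeriv j (φF : ℝ → ℂ) (-c * v)‖ := by
    rw [norm_smul, norm_pow, Real.norm_eq_abs, abs_neg, abs_of_pos hc0]
    exact mul_le_of_le_one_left (norm_nonneg _) (pow_le_one₀ hc0.le hc1)
  -- `(1+|v|) ≤ (2π)(1+|cv|)`
  have hscale : 1 + |v| ≤ (2 * Real.pi) * (1 + |c * v|) := by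
    rw [abs_mul, abs_of_pos hc0, hc]
    have : (2 * Real.pi) * (1 + (2 * Real.pi)⁻¹ * |v|) = 2 * Real.pi + |v| := by field_simp
    rw [this]; linarith [Real.pi_gt_three]
  have hscale' : 1 + |v| ≤ (2 * Real.pi) * (1 + |-c * v|) := by
    rw [neg_mul, abs_neg]; exact hscale
  have hv0 : 0 ≤ 1 + |v| := by positivity
  have hp1 : (1 + |v|) ^ 4 ≤ (2 * Real.pi) ^ 4 * (1 + |c * v|) ^ 4 := by
    rw [← mul_pow]; exact pow_le_pow_left₀ hv0 hscale 4
  have hp2 : (1 + |v|) ^ 4 ≤ (2 * Real.pi) ^ 4 * (1 + |-c * v|) ^ 4 := by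
    rw [← mul_pow]; exact pow_le_pow_left₀ hv0 hscale' 4
  calc (1 + |v|) ^ 4 * ‖c ^ j • iteratedDeriv j (φF : ℝ → ℂ) (c * v) +
          (-c) ^ j • iteratedDeriv j (φF : ℝ → ℂ) (-c * v)‖
      ≤ (1 + |v|) ^ 4 * (‖iteratedDeriv j (φF : ℝ → ℂ) (c * v)‖ +
          ‖iteratedDeriv j (φF : ℝ → ℂ) (-c * v)‖) := by
        gcongr
        exact (norm_add_le _ _).trans (add_le_add hn1 hn2)
    _ = (1 + |v|) ^ 4 * ‖iteratedDeriv j (φF : ℝ → ℂ) (c * v)‖ +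
          (1 + |v|) ^ 4 * ‖iteratedDeriv j (φF : ℝ → ℂ) (-c * v)‖ := by ring
    _ ≤ (2 * Real.pi) ^ 4 * (1 + |c * v|) ^ 4 * ‖iteratedDeriv j (φF : ℝ → ℂ) (c * v)‖ +
          (2 * Real.pi) ^ 4 * (1 + |-c * v|) ^ 4 * ‖iteratedDeriv j (φF : ℝ → ℂ) (-c * v)‖ := by
        gcongr
    _ = (2 * Real.pi) ^ 4 * ((1 + |c * v|) ^ 4 * ‖iteratedDeriv j (φF : ℝ → ℂ) (c * v)‖) +
          (2 * Real.pi) ^ 4 * ((1 + |-c * v|) ^ 4 * ‖iteratedDeriv j (φF : ℝ → ℂ) (-c * v)‖) := by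
        ring
    _ ≤ (2 * Real.pi) ^ 4 * C + (2 * Real.pi) ^ 4 * C := by gcongr
    _ = 2 * (2 * Real.pi) ^ 4 * C := by ring

/-- The cosine transform of `K₀` is `Re ∘ G`. [cite: ConreyIwaniec2002, §6 (6.2)] -/
private theorem ciL_K₀_eq : ciL K₀ = fun v => (G v).re := by
  ext v; rw [G_eq]; simp

/-- Auxiliary (proof-internal). [folklore] -/
private theorem ciL_K₀_contDiff (n : ℕ∞) : ContDiff ℝ n (ciL K₀) := by
  rw [ciL_K₀_eq]
  exact reCLM.contDiff.comp (G_contDiff n)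

/-- `(1+|v|)⁴ |L₀^{(j)}(v)| ≤ B_j` for the cosine transform `L₀ = ciL K₀`.
[cite: ConreyIwaniec2002, §6 (6.3)] -/
private theorem ciL_K₀_deriv_bound (j : ℕ) :
    ∃ B : ℝ, 0 ≤ B ∧ ∀ v : ℝ, (1 + |v|) ^ 4 * |iteratedDeriv j (ciL K₀) v| ≤ B := by
  obtain ⟨B, hB, hBb⟩ := G_deriv_bound j
  refine ⟨B, hB, fun v => le_trans ?_ (hBb v)⟩
  gcongr
  have h1 : |iteratedDeriv j (ciL K₀) v| = ‖iteratedFDeriv ℝ j (ciL K₀) v‖ := by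
    rw [norm_iteratedFDeriv_eq_norm_iteratedDeriv, Real.norm_eq_abs]
  have h2 : ‖iteratedDeriv j G v‖ = ‖iteratedFDeriv ℝ j G v‖ :=
    norm_iteratedFDeriv_eq_norm_iteratedDeriv.symm
  rw [h1, h2, ciL_K₀_eq, show (fun v => (G v).re) = reCLM ∘ G from rfl]
  calc ‖iteratedFDeriv ℝ j (⇑reCLM ∘ G) v‖ ≤ ‖reCLM‖ * ‖iteratedFDeriv ℝ j G v‖ :=
        ContinuousLinearMap.norm_iteratedFDeriv_comp_left reCLM (N := (j : ℕ∞))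
          ((G_contDiff j).contDiffAt) le_rfl
    _ ≤ 1 * ‖iteratedFDeriv ℝ j G v‖ := by
        gcongr; exact reCLM_norm.le
    _ = ‖iteratedFDeriv ℝ j G v‖ := one_mul _

/-- One constant for all `j ≤ 5`. [cite: ConreyIwaniec2002, §6 (6.3)] -/
private theorem ciL_K₀_deriv_bound_uniform :
    ∃ B : ℝ, 1 ≤ B ∧ ∀ j : ℕ, j ≤ 5 → ∀ v : ℝ, (1 + |v|) ^ 4 * |iteratedDeriv j (ciL K₀) v| ≤ B := by
  choose B hB hBb using ciL_K₀_deriv_bound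
  refine ⟨1 + ∑ j ∈ Finset.range 6, B j, by
    have : 0 ≤ ∑ j ∈ Finset.range 6, B j := Finset.sum_nonneg fun j _ => hB j
    linarith, fun j hj v => ?_⟩
  have hmem : j ∈ Finset.range 6 := Finset.mem_range.mpr (by omega)
  have hle : B j ≤ ∑ i ∈ Finset.range 6, B i :=
    Finset.single_le_sum (fun i _ => hB i) hmem
  linarith [hBb j v]

/-- Scaling the kernel scales the cosine transform. [cite: ConreyIwaniec2002, §6 (6.2)] -/
private theorem ciL_const_mul (c : ℝ) (K : ℝ → ℝ) : ciL (fun u => c * K u) = fun v => c * ciL K v := by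
  ext v
  unfold ciL
  have h : ∫ u in Ioi (0 : ℝ), c * K u * Real.cos (u * v) = c * ∫ u in Ioi (0 : ℝ), K u * Real.cos (u * v) := by
    rw [← integral_const_mul]
    refine setIntegral_congr_fun (measurableSet_Ioi (a := (0 : ℝ))) fun u _ => ?_
    ring
  rw [h]; ring

end KernelConstruction

open KernelConstruction in
/-- **An admissible kernel dominating `𝟙_{[1,2]}`** (registered stub S1 `stub_kernel` of SKELETON
P64): there are `K : ℝ → ℝ` and `c₀ > 0` with `IsCIKernel K` ((6.1)–(6.3) as typed), `K ≥ 0`, and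
`K ≥ c₀` on `[1, 2]` — namely `K = K₀/B`, `K₀(u) = φ(u) + φ(−u)`, `B ≥ 1` the uniform decay constant
of the first five derivatives of `ciL K₀ = Re(𝓕φ(·/2π) + 𝓕φ(−·/2π))`.
[cite: ConreyIwaniec2002, §6 (6.1)–(6.3); §5 (5.18)] -/
theorem exists_admissible_kernel :
    ∃ (K : ℝ → ℝ) (c₀ : ℝ), IsCIKernel K ∧ (∀ u, 0 ≤ K u) ∧ 0 < c₀ ∧
      ∀ u ∈ Set.Icc (1 : ℝ) 2, c₀ ≤ K u := by
  obtain ⟨B, hB1, hBb⟩ := ciL_K₀_deriv_bound_uniform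
  have hB0 : 0 < B := by linarith
  refine ⟨fun u => B⁻¹ * K₀ u, B⁻¹, ⟨?_, ?_, ?_, ?_, ?_, ?_⟩, fun u => ?_, inv_pos.mpr hB0, ?_⟩
  · exact continuous_const.mul K₀_continuous
  · intro u; simp [K₀_even]
  · simp [K₀_zero]
  · exact K₀_hasCompactSupport.mul_left
  · rw [ciL_const_mul]
    exact contDiff_const.mul (ciL_K₀_contDiff 5)
  · intro j hj v
    rw [ciL_const_mul]
    have hcd : ContDiffAt ℝ j (ciL K₀) v := ((ciL_K₀_contDiff j).contDiffAt)
    rw [iteratedDeriv_const_mul B⁻¹ hcd, abs_mul, abs_inv, abs_of_pos hB0]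
    have h := hBb j hj v
    have hpos : 0 < (1 + |v|) ^ 4 := by positivity
    rw [inv_mul_le_iff₀ hB0]
    calc |iteratedDeriv j (ciL K₀) v| = ((1 + |v|) ^ 4)⁻¹ * ((1 + |v|) ^ 4 * |iteratedDeriv j (ciL K₀) v|) := by
          field_simp
      _ ≤ ((1 + |v|) ^ 4)⁻¹ * B := by gcongr
      _ = B * ((1 + |v|) ^ 4)⁻¹ := mul_comm _ _
  · exact mul_nonneg (inv_nonneg.mpr hB0.le) (K₀_nonneg u)
  · intro u hu
    simp only [K₀_eq_one hu, mul_one, le_refl]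

end ConreyIwaniec2002

end Literature.NumberTheory.LFunctions

end
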